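import Literature.NumberTheory.EllipticCurves.ConjugatePairingRestrictedPerfectProofs
import Literature.NumberTheory.EllipticCurves.TorsionFilAtCardProofs
import Literature.NumberTheory.EllipticCurves.TorsionFilAtStrictTransportProofs
import HarnessLib

/-!
# Howard's Lemma 3.1.1 at the `E`-level for the conjugate pairing `ẽ = log e(·, τ_* ·)`: `Fil_v E[p^j] × E[p^j]/δ_v·Fil_{σv} E[p^j]`
# is perfectly paired (theorems only; no definition, no named fact, no instance, no `sorry`)

Topic `NumberTheory/EllipticCurves` (cell `pub/bsd-print-x9`, brick (B3) of `HOME/p1/H4-EXACT-AT-P-PLAN`; sequel to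
`ConjugatePairingRestrictedPerfectProofs` (finite-group duality: (E-orth)/(E-R)/(E-S) for `e(a, θ b)`), `TorsionFilAtCardProofs`
(`#Fil_v E[p^k] · #Fil_v E[p^k] = #E[p^k]`), `TorsionFilAtCyclicOrdinaryProofs` (isotropy of `Fil_v`) and
`TorsionFilAtStrictTransportProofs` / `LocalKernelOfReductionGaloisTransportProofs` (`τ_* δ_v : Fil_{σv} E[n] → Fil_v E[n]`, into and
onto, for the canonical conjugation datum `ConjugationDatum.ofLifts`)).

Howard [Compositio Math. 140 (2004), Rem. 1.3.2, §1.3 H.4, Lemma 3.1.1; arXiv:1202.6340 p. 7 L69–88, p. 15 L56–62]: the H.4 pairing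
of `T_p E` is `(s, t) ↦ e_W(s, t^τ)`, and «`Fil_v(T_𝔭)` is its own exact orthogonal complement».  For the `E`-level form
`ẽ_j = conjPairing (e j) τ_* (log j) : E[p^j] × E[p^j] → ℤ/p^j` of the D-family's duality data (`(D k).e = eisensteinDualityForm hm (k+1) ẽ_{k+1}`)
this file proves the three `E`-LEVEL clauses consumed by `ZpExtensionEisensteinTwistRestrictedDualityProofs` (lift to
`A_{m,j} ⊗ ·`) and then by `Howard2004/DualityDatumRestrictedPairingProofs` (non-degeneracy of the restricted cup product):

* §1 generic `M` (finite, `n`-torsion), `e : M × M → μₙ` alternating with trivial right kernel, `θ` an involution carrying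
  `A′` ONTO an `e`-isotropic `A` with `#A · #A = #M`, `log : μₙ ≅ ℤ/n`:
  **`conjPairing_restricted_clauses`** — (E-orth) `ẽ(A, A′) = 0`, (E-R) `{b | ẽ(A, b) = 0} ⊆ A′`, (E-S) every `φ : A →+ ℤ/n` is
  `ẽ(·, b)|_A`;
* §2 the curve: `M = E_K[p^j]`, `A = Fil_v E[p^j]` (`WeierstrassCurve.torsionFilAt`), `A′ = δ_v · Fil_{σv} E[p^j]`, `θ = τ_*`, for the
  canonical datum `ofLifts σ … τ …` at a place `v ∋ p` of good reduction with an ordinary point: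
  **`WeierstrassCurve.conjPairing_torsionFilAt_clauses`** — the same three clauses, from `pairing_torsionFilAt_eq_zero`,
  `natCard_torsionFilAt_mul_self`, `torsionMap_delta_apply_mem_torsionFilAt`, `exists_torsionMap_delta_apply_eq_of_mem_torsionFilAt`.
  The right non-degeneracy of the Weil pairing `e j` on `E[p^j]` is an explicit hypothesis (the D-family's
  `exists_weilPairingHom_tower_baseChange` supplies it).

No summit statement is proved; BSD is not proved by any of this.  Seat `bsd-line-x10b-p1-w7` g2.

References: [Howard2004HeegnerKolyvagin] Rem. 1.3.2, §1.3 H.4, §3.1, Lemma 3.1.1 (arXiv:1202.6340 p. 7 L69–88, p. 15 L56–62);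
[GreenbergLNM1716] §2 (pp. 82–83); [SilvermanAEC2009] III.8.1 (Weil pairing perfect, alternating), VII.2 Props. 2.1–2.2;
[MilneADT2006] I §0 Prop. 0.19.
-/

noncomputable section

open Function NumberField IsDedekindDomain Field

namespace Literature.NumberTheory.EllipticCurves

open Literature.NumberTheory.GaloisRepresentations Literature.NumberTheory.GaloisCohomology.Howard2004

universe u

/-! ## §1 The three `E`-level clauses for `ẽ = log e(·, θ ·)` on a finite group -/

/-- **(E-orth), (E-R), (E-S) for the conjugate pairing `ẽ(a, b) = log e(a, θ b)`** (`conjPairing e θ log`): for `M` finite and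
`n`-torsion, `e : M × M → μₙ` alternating with trivial right kernel, `log : μₙ → ℤ/n` injective, `θ` an involution carrying `A′`
onto the isotropic subgroup `A` with `#A · #A = #M`:  `ẽ(A, A′) = 0`;  `ẽ(A, b) = 0 ⇒ b ∈ A′`;  every additive `φ : A → ℤ/n` is
`a ↦ ẽ(a, b)` for some `b` — i.e. `ẽ` induces a perfect pairing `A × M/A′ → ℤ/n`.
[cite: Howard2004HeegnerKolyvagin, Rem. 1.3.2 and Lemma 3.1.1 (arXiv:1202.6340 p. 7 L81–88, p. 15 L60–62)] [cite: MilneADT2006, I §0 Prop. 0.19] -/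
theorem conjPairing_restricted_clauses {K : Type u} [Field K] {M : Type u} [AddCommGroup M] [TopologicalSpace M]
    [DiscreteTopology M] [Finite M] {n : ℕ} [NeZero n] (e : M →+ M →+ DiscreteGaloisModule.MuCarrier K n) (θ : M →+ M)
    (log : DiscreteGaloisModule.MuCarrier K n →+ ZMod n) (hlog : Injective log) (hM : ∀ x : M, n • x = 0)
    (hnd : ∀ b : M, (∀ a : M, e a b = 0) → b = 0) (hθθ : ∀ x, θ (θ x) = x)
    (A A' : Submodule ℤ M) (hiso : ∀ a ∈ A, ∀ a' ∈ A, e a a' = 0) (hcard : Nat.card A * Nat.card A = Nat.card M)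
    (hθ : ∀ x ∈ A', θ x ∈ A) (hθ' : ∀ y ∈ A, ∃ x ∈ A', θ x = y) :
    (∀ a ∈ A, ∀ b ∈ A', conjPairing e θ log a b = 0) ∧
      (∀ b : M, (∀ a ∈ A, conjPairing e θ log a b = 0) → b ∈ A') ∧
      (∀ φ : A →+ ZMod n, ∃ b : M, ∀ a : A, conjPairing e θ log (a : M) b = φ a) := by
  -- the `ℤ/n`-valued pairing `e₀ = log ∘ e`
  let e₀ : M →+ M →+ ZMod n := e.compr₂ log
  have he₀ : ∀ a b, e₀ a b = log (e a b) := fun a b ↦ rfl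
  have hconj : ∀ a b, conjPairing e θ log a b = e₀ a (θ b) := fun a b ↦ rfl
  have hnd₀ : ∀ b : M, (∀ a : M, e₀ a b = 0) → b = 0 := fun b hb ↦ hnd b fun a ↦ hlog (by
    rw [map_zero]; exact hb a)
  have hiso₀ : ∀ a ∈ A, ∀ a' ∈ A, e₀ a a' = 0 := fun a ha a' ha' ↦ by rw [he₀, hiso a ha a' ha', map_zero]
  refine ⟨fun a ha b hb ↦ ?_, fun b hb ↦ ?_, fun φ ↦ ?_⟩
  · rw [hconj]
    exact conjPairing_restricted_eq_zero e₀ θ A A' hθ hiso₀ ha hb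
  · exact conjPairing_restricted_right_exact e₀ θ A A' hθ' hθθ hM hnd₀ hiso₀ hcard fun a ha ↦ hb a ha
  · obtain ⟨b, hb⟩ := conjPairing_restricted_right_exhausting e₀ θ A A' hθ hθ' hθθ hM hnd₀ hiso₀ hcard φ
    exact ⟨b, fun a ↦ hb a⟩

end Literature.NumberTheory.EllipticCurves

/-! ## §2 The curve: `Fil_v E[p^j]`, `δ_v · Fil_{σv} E[p^j]`, `θ = τ_*` -/

namespace WeierstrassCurve

open Literature.NumberTheory.EllipticCurves Literature.NumberTheory.GaloisRepresentations
open Literature.NumberTheory.GaloisCohomology.Howard2004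

variable {K : Type} [Field K] [NumberField K] (W : WeierstrassCurve ℚ) [W.IsElliptic] {p : ℕ} [hp : Fact p.Prime]
  (σ : K ≃ₐ[ℚ] K) (hσ₁ : σ ≠ 1) (hσ : σ * σ = 1) (τ : AlgebraicClosure K ≃+* AlgebraicClosure K)
  (hτ : IsLiftOfAut σ τ) (hτ₂ : Function.Involutive τ)

/-- **Howard's Lemma 3.1.1 at the `E`-level for `ẽ_j = log e_j(·, τ_* ·)`** at a place `v ∋ p` of good reduction with an ordinary
point (good ORDINARY reduction), for the canonical conjugation datum `ofLifts σ … τ …`: with `A = Fil_v E_K[p^j]` and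
`A′ = δ_v · Fil_{σv} E_K[p^j]` (the `δ_v`-translate appearing in the transport of the strict condition at `σ v`,
`TransportStrictProofs`) —  (E-orth) `ẽ_j(A, A′) = 0`,  (E-R) `ẽ_j(A, b) = 0 ⇒ b ∈ A′`,  (E-S) every `φ : A →+ ℤ/p^j` is `ẽ_j(·, b)|_A`.
Inputs: `e_j` alternating with trivial right kernel on `E_K[p^j]` (Weil pairing), `log_j` injective, `τ_*` involutive on `E[p^j]`.
These are the `E`-level hypotheses of `ZpExtension.mem_span_tmul_of_forall_tailFormZMod_eisensteinDualityForm_eq_zero` /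
`exists_forall_tailFormZMod_eisensteinDualityForm_eq_of_mem_span_tmul` for the D-family's level-`j` duality form.
[cite: Howard2004HeegnerKolyvagin, Rem. 1.3.2, §3.1 and Lemma 3.1.1 (arXiv:1202.6340 p. 7 L81–88, p. 15 L56–62)]
[cite: GreenbergLNM1716, §2 (pp. 82–83)] [cite: SilvermanAEC2009, III.8.1 and VII.2 Props. 2.1–2.2] -/
theorem conjPairing_torsionFilAt_clauses (v : HeightOneSpectrum (𝓞 K)) (hgood : (W.baseChange K).HasGoodReductionAt v)
    (hpv : (p : 𝓞 K) ∈ v.asIdeal)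
    (hord : ∃ P : localPoints (W.baseChange K) (v.adicCompletion K), (p : ℤ) • P = 0 ∧
      P ∉ (W.baseChange K).localKernelOfReduction v)
    (j : ℕ) (e : geomTorsion (W.baseChange K) ((p : ℤ) ^ j) →+ geomTorsion (W.baseChange K) ((p : ℤ) ^ j) →+
      DiscreteGaloisModule.MuCarrier K (p ^ j))
    (log : DiscreteGaloisModule.MuCarrier K (p ^ j) →+ ZMod (p ^ j)) (hlog : Injective log)
    (halt : ∀ a, e a a = 0) (hnd : ∀ b, (∀ a, e a b = 0) → b = 0)
    (hθθ : ∀ a : geomTorsion (W.baseChange K) ((p : ℤ) ^ j), hτ.torsionMap W _ (hτ.torsionMap W _ a) = a) :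
    let eb := conjPairing e (hτ.torsionMap W ((p : ℤ) ^ j)) log
    let A := (W.baseChange K).torsionFilAt v ((p : ℤ) ^ j)
    let A' := ((W.baseChange K).torsionFilAt (σ • v) ((p : ℤ) ^ j)).map
      ((W.baseChange K).torsionGaloisModule ((p : ℤ) ^ j) ((ConjugationDatum.ofLifts σ hσ₁ hσ τ hτ hτ₂).δ v))
    (∀ a ∈ A, ∀ b ∈ A', eb a b = 0) ∧ (∀ b, (∀ a ∈ A, eb a b = 0) → b ∈ A') ∧
      (∀ φ : A →+ ZMod (p ^ j), ∃ b, ∀ a : A, eb (a : geomTorsion (W.baseChange K) ((p : ℤ) ^ j)) b = φ a) := by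
  intro eb A A'
  haveI : NeZero (p ^ j) := ⟨pow_ne_zero j hp.out.ne_zero⟩
  have hn : ((p : ℤ) ^ j) ≠ 0 := pow_ne_zero j (Nat.cast_ne_zero.mpr hp.out.ne_zero)
  haveI : Finite (geomTorsion (W.baseChange K) ((p : ℤ) ^ j)) :=
    finite_torsionPoints_holds (W.baseChange K) (AlgebraicClosure K) hn
  haveI : CharZero ((σ • v).adicCompletion K) := charZero_of_injective_algebraMap (algebraMap K _).injective
  haveI : CharZero (v.adicCompletion K) := charZero_of_injective_algebraMap (algebraMap K _).injective
  set θ := hτ.torsionMap W ((p : ℤ) ^ j) with hθdef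
  set δ := (W.baseChange K).torsionGaloisModule ((p : ℤ) ^ j) ((ConjugationDatum.ofLifts σ hσ₁ hσ τ hτ hτ₂).δ v) with hδ
  -- the inputs of the generic statement
  have hM : ∀ x : geomTorsion (W.baseChange K) ((p : ℤ) ^ j), (p ^ j) • x = 0 := fun x ↦ Subtype.ext (by
    rw [AddSubgroupClass.coe_nsmul, ZeroMemClass.coe_zero, ← natCast_zsmul, Nat.cast_pow]
    exact (Submodule.mem_torsionBy_iff _ _).mp x.2)
  have hiso : ∀ a ∈ A, ∀ a' ∈ A, e a a' = 0 :=
    (W.baseChange K).pairing_torsionFilAt_eq_zero v hgood hpv hord j e halt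
  have hcard : Nat.card A * Nat.card A = Nat.card (geomTorsion (W.baseChange K) ((p : ℤ) ^ j)) :=
    (W.baseChange K).natCard_torsionFilAt_mul_self v hgood hpv hord j
  have hθA : ∀ x ∈ A', θ x ∈ A := by
    intro x hx
    obtain ⟨a', ha', rfl⟩ := Submodule.mem_map.mp hx
    exact W.torsionMap_delta_apply_mem_torsionFilAt σ hσ₁ hσ τ hτ hτ₂ v _ ha'
  have hθA' : ∀ y ∈ A, ∃ x ∈ A', θ x = y := by
    intro y hy
    obtain ⟨a', ha', h⟩ := W.exists_torsionMap_delta_apply_eq_of_mem_torsionFilAt σ hσ₁ hσ τ hτ hτ₂ v hn hy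
    exact ⟨δ a', Submodule.mem_map.mpr ⟨a', ha', rfl⟩, h⟩
  exact conjPairing_restricted_clauses e θ log hlog hM hnd hθθ A A' hiso hcard hθA hθA'

end WeierstrassCurve

end
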